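import Literature.MathematicalPhysics.QuantumFieldTheory.Balaban1983to89.B6Prop27PrintedKernelKLevelV1
import Literature.MathematicalPhysics.QuantumFieldTheory.Balaban1983to89.B6QGQCoerciveKLevelV1
import Literature.MathematicalPhysics.QuantumFieldTheory.Balaban1983to89.B6KLevelFamilyWitnessV1
import Literature.MathematicalPhysics.QuantumFieldTheory.Balaban1983to89.B6KLevelCensusIndexV1
import HarnessLib

/-!
# `Balaban1983to89.B6Prop27PrintedKLevelV1` — T. Bałaban, *Propagators and renormalization transformations for lattice gauge theories. II*,
Comm. Math. Phys. **96** (1984) 223–250 [Balaban1984PropagatorsII], p. 249 **PROPOSITION 2.7 (2.149) — THE VERBATIM CENSUS TYPING `…B6.Prop27Printed`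
INHABITED HYPOTHESIS-FREE ON THE GENUINE k-LEVEL V1 FAMILY** (every number of levels `k ≥ 2`; B6-CLOSURE §5 item 19, second half; owner r03): the
index `KIdx` (= the binder list of ROUTE W `B6QGQCoerciveKLevelV1.prop27_kLevel_unconditional`: V1 parameters, a nested k-level torus family `D` with
`M_h = L^a ≥ 8`, `R ≥ 2L²`, `P′ ≥ 5`, odd `L ≥ 5`, every cube placed, a fine-lattice factor `c_f ≠ 0`, weights in the band (2.16)) and the geometry
`kGeo` (`Site := 𝔅` (the index bonds), `scale := level`, `η := |c_f|⁻¹`, `dist := d_T(βb, βb′)` (p21's torus distance (2.46) of the carrier blocks),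
`M := L·M_h`) are those of `B6KLevelCensusIndexV1` (BY NAME), and the kernel is PRINT'S (2.69)/(2.150)-kernel of the genuine `(QGQ*)⁻¹ = EE (domT hN D hk)` (dictionary of `B6Prop27PrintedKernelKLevelV1`):
`(QGQ*)⁻¹(b,b′) := L^{−j(b)D}·(L^{j(b′)}η)^{−D}·⟪e_b, EE e_{b′}⟫`.

HONEST FRAMING (programme rule): statement-level skeleton of published theorems with citation tags; proofs where landed; nothing here
is a claim about the Yang–Mills mass gap.

PRINT (verbatim, p. 249, = the docstring of `…B6.Prop27Printed`): «Proposition 2.7. The operator (QGQ*)⁻¹ is given by the convergent expansions of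
the form (2.86), and it satisfies the bound |(QGQ*)⁻¹(b, b′)| ≤ O(1)(L^jη)^{−2}(L^{j′}η)^{−d}e^{−½δ₄d(b,b′)}, b ∈ Λ_j, b′ ∈ Λ_{j′}. (2.149)».

## WHAT THIS FILE CERTIFIES (kernel-checked, sorry-free, standard axioms)

* §1 `kQinv i : B6.SiteKernel (kGeo i)` (print's kernel) on the index `KIdx`/geometry `kGeo` of `B6KLevelCensusIndexV1`;
* §2 **`prop27_kLevel_printedKernel`** — PROP. 2.7 (2.149) IN PRINT'S KERNEL NORMALISATION AT k LEVELS, HYPOTHESIS-FREE: the theorem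
  `B6Prop27PrintedKernelKLevelV1.prop27_kLevel_printedKernel_of_2147` (binders of W3's `prop27_kLevel` verbatim, the level-weighted (2.147) displayed)
  at `γ := γ₀ = gam0 d ℓ b₁` with (2.147) DISCHARGED by ROUTE W part W1 (`B6QGQCoerciveKLevelV1.qgq_coercive_kLevel`, `hwup_of_globalBand`, BY NAME);
  **`prop27Printed_kLevel : B6.Prop27Printed (d + 1) kGeo kQinv`** for every `d`, odd `L ≥ 5` (`ℓ ≥ 4` is a field of the index) and band
  `0 < b₀ ≤ b₁` — witnesses `M₁ = max M₂ (N₁ + 1)` (ONE printed threshold `M₁ ≤ M = L·M_h` covers both thresholds of ROUTE W since `R ≥ 1`),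
  `δ₄`, `O(1) = C` of `prop27_kLevel_printedKernel` at `σ := σ₁`, `α := ½`;
* §3 `kLevel27_meets_hypotheses`: NON-VACUITY at `L = 5` — for every threshold `M₁` and every `k ≥ 2` there is an index with `M₁ ≤ M`
  (`B6KLevelFamilyWitnessV1.kLevelFamily_nonvacuous_L5`).

## HONEST SCOPE

(1) The BOUND (2.149) only, not the expansion (2.86) (as W3 and p22's two-scale instance).  (2) The family is the V1 torus family of ROUTE V/W
(`k ≥ 2`; for odd `L ≥ 7` the placement field must be supplied by the user — non-vacuity is certified at `L = 5` only).  (3) `O(1)`, `δ₄` depend on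
`d, L` AND the band `b₀, b₁` (print: on `d, L`; the band is print's (2.16)).  (4) `dist` = the torus graph distance of the carrier blocks, `η = |c_f|⁻¹`,
kernel w.r.t. the (2.69) pairing — the readings of `B6Prop27PrintedKernelKLevelV1` (its module docstring gives the dictionary and the text-layer
locators p. 225 (2.11)/(2.14), p. 235 (2.69), p. 248).  DEFINITIONS (data) + THEOREMS; no `def … : Prop` fact.  NOT summit progress.
Unit `lit-balaban-r03` (gens 24–26), 2026-08-23/24 (gen 25: the hypothesis-free kernel-normalised corollary is proved HERE, importing W1 part 2
directly; gen 26: the index/geometry moved to `B6KLevelCensusIndexV1`, shared with the Cor. 2.8 and Prop. 2.6 censuses; statements unchanged).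
-/

noncomputable section

open scoped InnerProductSpace

namespace Literature.MathematicalPhysics.QuantumFieldTheory.Balaban1983to89.B6Prop27PrintedKLevelV1

open LatticeFieldCalculus
open B6SectAOperatorsV1 (BondIdx BondIdxSpace)
open B6SectAVectorModelV1 (EE)
open B6MultiLevelBoxOperator (N0)
open B6MultiLevelTorusOperator (TDomains)
open B6GlobalChartV1 (PV domT blkV1)
open B6Geom246MultiLevelTorus (geomT)
open B6Ineq2142KLevelV1 (lvl β)
open B6CubeWindowV1 (Placed GlobalBand)
open B6Cover236MultiLevelBlocks (cubes)
open B6Prop27PrintedKernelKLevelV1 (prop27_kLevel_printedKernel_of_2147)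
open B6Cor28KLevelV1 (two_le_RMh)
open B6QGQCoerciveKLevelV1 (gam0 gam0_pos qgq_coercive_kLevel hwup_of_globalBand)
open B6KLevelCensusIndexV1 (KIdx kGeo len_eq len_pos)

variable {d ℓ : ℕ} {hd : 1 ≤ d + 1} {hL : Odd (ℓ + 1) ∧ 1 < ℓ + 1} {b₀ b₁ : ℝ}

/-! ## §1  The kernel reading (on the index `KIdx` and the bond-site geometry `kGeo` of `B6KLevelCensusIndexV1`) -/

/-- **print's kernel of `(QGQ*)⁻¹`** w.r.t. the (2.69)/(2.150) pairing: `(QGQ*)⁻¹(b,b′) := L^{−j(b)D}·(L^{j(b′)}η)^{−D}·⟪e_b, EE e_{b′}⟫`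
(dictionary in `B6Prop27PrintedKernelKLevelV1`). [cite: Balaban1984PropagatorsII, (2.69) p.235, (2.149)–(2.150) p.249] -/
def kQinv (i : KIdx d ℓ hd hL b₀ b₁) : B6.SiteKernel (kGeo i) where
  ker := fun b b' => ((((ℓ + 1 : ℕ) : ℝ) ^ (d + 1)) ^ (lvl i.hN i.D i.hk b))⁻¹ *
    (((((ℓ + 1 : ℕ) : ℝ)) ^ (lvl i.hN i.D i.hk b') / |i.cf|) ^ (d + 1))⁻¹ *
      ⟪EuclideanSpace.single b (1 : ℝ), EE (domT i.hN i.D i.hk) i.hcf i.hw (EuclideanSpace.single b' (1 : ℝ))⟫_ℝ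

/-! ## §2  Proposition 2.7 at k levels: print's kernel normalisation hypothesis-free, then the verbatim census typing -/

/-- **[B6] PROPOSITION 2.7 (2.149) IN PRINT'S KERNEL NORMALISATION, AT k LEVELS, HYPOTHESIS-FREE**: `prop27_kLevel_printedKernel_of_2147` at
`γ := γ₀ = gam0 d ℓ b₁` with the level-weighted (2.147) DISCHARGED by ROUTE W part W1 (`B6QGQCoerciveKLevelV1.qgq_coercive_kLevel`,
`hwup_of_globalBand`); binders of `B6QGQCoerciveKLevelV1.prop27_kLevel_unconditional` verbatim (`M₂`, `N₁` enlarged).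
[cite: Balaban1984PropagatorsII, Prop. 2.7 (2.149) p.249, (2.147)–(2.148) p.248, (2.69) p.235] -/
theorem prop27_kLevel_printedKernel (d ℓ : ℕ) (hd : 1 ≤ d + 1) (hL : Odd (ℓ + 1) ∧ 1 < ℓ + 1) {b₀ b₁ : ℝ} (hb₀ : 0 < b₀) (hb₁ : b₀ ≤ b₁) :
    ∃ σ₁ : ℝ, 0 < σ₁ ∧ ∀ (σ : ℝ), 0 < σ → σ ≤ σ₁ → ∀ (α : ℝ), 0 < α → α < 1 →
    ∃ (δ₄ C M₂ : ℝ) (N₁ : ℕ), 0 < δ₄ ∧ 0 < C ∧ 0 < M₂ ∧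
    ∀ (m K : ℕ) {Mh k R : ℕ} {P' : Fin (d + 1) → ℕ}
      (hN : ∀ μ, N0 ℓ Mh k P' μ = (PV d ℓ m K hd hL).sitesPerDir 0) (D : TDomains d ℓ Mh k P' R) (hk : k ≤ m + K) (_ : 2 ≤ k)
      {a : ℕ} (_ : Mh = (ℓ + 1) ^ a) (_ : 8 ≤ Mh) (_ : 2 * (ℓ + 1) ^ 2 ≤ R) (_ : ∀ μ, 5 ≤ P' μ) (_ : 4 ≤ ℓ)
      (_ : ∀ c : ↥(cubes D.toDomains), Placed ℓ k P' c.1) (_ : M₂ ≤ ((ℓ : ℝ) + 1) * Mh) (_ : N₁ + 1 ≤ R * ((ℓ + 1) * Mh))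
      {cf : ℝ} (hcf : cf ≠ 0) {w : BondIdx (domT hN D hk) → ℝ} (hw : ∀ i, 0 < w i) (_ : GlobalBand b₀ b₁ cf w),
      ∀ b b' : BondIdx (domT hN D hk),
        |((((ℓ + 1 : ℕ) : ℝ) ^ (d + 1)) ^ (lvl hN D hk b))⁻¹ * (((((ℓ + 1 : ℕ) : ℝ)) ^ (lvl hN D hk b') / |cf|) ^ (d + 1))⁻¹ *
            ⟪EuclideanSpace.single b (1 : ℝ), EE (domT hN D hk) hcf hw (EuclideanSpace.single b' (1 : ℝ))⟫_ℝ| ≤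
          C * (((((ℓ + 1 : ℕ) : ℝ)) ^ (lvl hN D hk b) / |cf|) ^ 2)⁻¹ * (((((ℓ + 1 : ℕ) : ℝ)) ^ (lvl hN D hk b') / |cf|) ^ (d + 1))⁻¹ *
            Real.exp (-(δ₄ / 2 * (geomT D).dist (β hN D hk b) (β hN D hk b'))) := by
  obtain ⟨σ₁, hσ₁, h⟩ := prop27_kLevel_printedKernel_of_2147 d ℓ hd hL hb₀ hb₁
  refine ⟨σ₁, hσ₁, fun σ hσ hσ1 α hα hα1 => ?_⟩
  have hb₁0 : 0 ≤ b₁ := hb₀.le.trans hb₁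
  obtain ⟨δ₄, C, M₂, N₁, hδ₄, hC, hM₂, hK⟩ := h σ hσ hσ1 α hα hα1 (gam0 d ℓ b₁) (gam0_pos d ℓ hb₁0)
  refine ⟨δ₄, C, M₂, N₁, hδ₄, hC, hM₂, ?_⟩
  intro m K Mh k R P' hN D hk hk2 a hMha hM8 hR2 hP5 hℓ hpl hM hRM cf hcf w hw hwb b b'
  exact hK m K hN D hk hk2 hMha hM8 hR2 hP5 hℓ hpl hM hRM hcf hw hwb
    (qgq_coercive_kLevel hN D hk (le_trans one_le_two hk2) hℓ (two_le_RMh hR2 hM8) hcf hb₁0 hw (hwup_of_globalBand hN D hk hcf hwb)) b b'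


/-- **PROPOSITION 2.7 (2.149), VERBATIM (`B6.Prop27Printed (d+1)`), ON THE GENUINE k-LEVEL V1 FAMILY WITH NO HYPOTHESIS**: witnesses
`M₁ = max M₂ (N₁ + 1)`, `δ₄`, `C` of `prop27_kLevel_printedKernel` at `σ := σ₁`, `α := ½`. [cite: Balaban1984PropagatorsII, Prop. 2.7 (2.149) p.249] -/
theorem prop27Printed_kLevel (hb₀ : 0 < b₀) (hb₁ : b₀ ≤ b₁) :
    B6.Prop27Printed (d + 1) (fun i : KIdx d ℓ hd hL b₀ b₁ => kGeo i) (fun i => kQinv i) := by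
  obtain ⟨σ₁, hσ₁, h⟩ := prop27_kLevel_printedKernel d ℓ hd hL hb₀ hb₁
  obtain ⟨δ₄, C, M₂, N₁, hδ₄, hC, hM₂, hK⟩ := h σ₁ hσ₁ le_rfl (1 / 2) (by norm_num) (by norm_num)
  clear h
  refine ⟨max M₂ ((N₁ : ℝ) + 1), δ₄, C, lt_max_of_lt_left hM₂, hδ₄, hC, fun i _ hM b b' => ?_⟩
  -- the two thresholds of ROUTE W from the one printed threshold `M₁ ≤ M = L·M_h`
  have hM' : max M₂ ((N₁ : ℝ) + 1) ≤ (((ℓ + 1 : ℕ) : ℝ)) * (i.Mh : ℝ) := hM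
  have hcast : (((ℓ + 1 : ℕ) : ℝ)) = (ℓ : ℝ) + 1 := by push_cast; ring
  have hM2 : M₂ ≤ ((ℓ : ℝ) + 1) * i.Mh := by rw [← hcast]; exact (le_max_left _ _).trans hM'
  have hR1 : 1 ≤ i.R := le_trans (Nat.one_le_two_pow) (le_trans (Nat.pow_le_pow_left (by omega : 2 ≤ ℓ + 1) 2 |>.trans (Nat.le_mul_of_pos_left _ (by norm_num))) i.hR2)
  have hRM : N₁ + 1 ≤ i.R * ((ℓ + 1) * i.Mh) := by
    have h1 : ((N₁ : ℝ) + 1) ≤ (((ℓ + 1 : ℕ) : ℝ)) * (i.Mh : ℝ) := (le_max_right _ _).trans hM'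
    have h2 : N₁ + 1 ≤ (ℓ + 1) * i.Mh := by exact_mod_cast h1
    exact h2.trans (Nat.le_mul_of_pos_left _ hR1)
  have h := hK i.m i.K i.hN i.D i.hk i.hk2 i.hMha i.hM8 i.hR2 i.hP5 i.hℓ i.hpl hM2 hRM i.hcf i.hw i.hwb b b'
  -- the census shape: real powers of the lengths
  have hlb := len_pos i b
  have hlb' := len_pos i b'
  have e2 : (kGeo i).len b ^ (-(2 : ℝ)) = (((((ℓ + 1 : ℕ) : ℝ)) ^ (lvl i.hN i.D i.hk b) / |i.cf|) ^ 2)⁻¹ := by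
    rw [Real.rpow_neg hlb.le, ← len_eq]; norm_cast
  have eD : (kGeo i).len b' ^ (-((d + 1 : ℕ) : ℝ)) = (((((ℓ + 1 : ℕ) : ℝ)) ^ (lvl i.hN i.D i.hk b') / |i.cf|) ^ (d + 1))⁻¹ := by
    rw [Real.rpow_neg hlb'.le, Real.rpow_natCast, ← len_eq]
  show |(kQinv i).ker b b'| ≤ C * (kGeo i).len b ^ (-(2 : ℝ)) * (kGeo i).len b' ^ (-((d + 1 : ℕ) : ℝ)) *
    Real.exp (-(δ₄ / 2 * (geomT i.D).dist (β i.hN i.D i.hk b) (β i.hN i.D i.hk b')))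
  rw [e2, eD]
  exact h

/-! ## §3  Non-vacuity at `L = 5` -/

/-- **NON-VACUITY** (`L = 5`): for every census threshold `M₁`, every `k ≥ 2` and every band there is an index of the family with `M₁ ≤ M = L·M_h`
(and `Hyp21_22` trivially) — `B6KLevelFamilyWitnessV1.kLevelFamily_nonvacuous_L5` (two top levels, `P′ = 2·5²`, `R = 2·5²`, `c_f = 1`).
[cite: Balaban1984PropagatorsII, Prop. 2.7 p.249, (2.2) p.224] -/
theorem kLevel27_meets_hypotheses (d k : ℕ) (hd : 1 ≤ d + 1) (hL : Odd (4 + 1) ∧ 1 < 4 + 1) (hk : 2 ≤ k) (M₁ : ℝ)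
    {b₀ b₁ : ℝ} (hb₀ : 0 < b₀) (hb₁ : b₀ ≤ b₁) :
    ∃ i : KIdx d 4 hd hL b₀ b₁, i.k = k ∧ (kGeo i).Hyp21_22 ∧ M₁ ≤ (kGeo i).M := by
  obtain ⟨m, K, Mh, R, a, P', hN, D, hk', w, hMha, hM8, hR2, hP5, -, hpl, hM, -, hw, hwb, -, -⟩ :=
    B6KLevelFamilyWitnessV1.kLevelFamily_nonvacuous_L5 d k hd hL hk M₁ 0 hb₀ hb₁
  refine ⟨⟨m, K, Mh, k, R, a, P', hN, D, hk', hk, hMha, hM8, hR2, hP5, le_rfl, hpl, 1, one_ne_zero, w, hw, hwb⟩, rfl, trivial, ?_⟩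
  show M₁ ≤ (((4 + 1 : ℕ) : ℝ)) * (Mh : ℝ)
  have hcast : (((4 + 1 : ℕ) : ℝ)) = ((4 : ℕ) : ℝ) + 1 := by push_cast; ring
  rw [hcast]; exact hM

end Literature.MathematicalPhysics.QuantumFieldTheory.Balaban1983to89.B6Prop27PrintedKLevelV1

end
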